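import Summits.AtomisticToContinuum.FouriersLaw.Theses.HonestZwanzig
import Summits.AtomisticToContinuum.FouriersLaw.Theorems.HonestZwanzigParityStatics
import Summits.AtomisticToContinuum.FouriersLaw.Theorems.HonestZwanzigFeshbachIdentitiesCovariance

/-!
# HonestZwanzig / PositiveMemory — the free static variance floor (stub S3 of line `Sketch`)

Support file for item `stmt-AtomisticToContinuum-12694` (`PositiveMemory` of route `HonestZwanzig`,
sub-problem `FouriersLaw`). For the pinned anharmonic chain `P = pinnedChain ω₂ lam β γ`, `T > 0`, the
Gibbs measure `μ_T = gibbsMeasure N T = Z⁻¹ e^{-H/T} dq dp` and the symmetrically split site energies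
`e_x = p_x²/2 + b_x(q)` (`b_x = U(q_x) + ½` adjacent bond potentials), the static covariance matrix
`χ_{xy} = cov(e_x, e_y)` dominates the free (momentum) one: for every site profile `ζ`,
`ζᵀχζ ≥ (T²/2) Σ_x ζ_x²`.
Under `μ_T` the momenta are i.i.d. `N(0,T)` and independent of the positions (Gaussian integration by
parts in one momentum, `pinnedChain_integral_indep_sq_momentum_mul_gibbsDensity`; moments
`E p² = T`, `E p⁴ = 3T²`), so entrywise
`cov(e_x, e_y) = cov(p_x²/2, p_y²/2) + cov(b_x, b_y) = [x = y] T²/2 + cov(b_x, b_y)` (the cross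
covariances vanish), and `Σ ζ_x ζ_y cov(b_x, b_y) = ∫ (B_ζ - μ_T B_ζ)² dμ_T ≥ 0`
(`pinnedChain_sum_cov_eq_integral_sq_sub`). Layers: Gibbs moments of `p_x²/2` against `μ_T`, the
entrywise splitting `cov_halfSqMomentum_add_potSite` for generic families `e, b` with defining
hypotheses (instantiated by `rfl` at the route), and the registered stub `stub_profileVariance`.
-/

noncomputable section

open MeasureTheory Finset Real Set Filter
open Literature.MathematicalPhysics.KineticTheory.HeatConduction
open Summit.AtomisticToContinuum.FouriersLaw.Theorems.SubdiffusiveBondHeat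

namespace Summit.AtomisticToContinuum.FouriersLaw.Theorems.HonestZwanzig.PositiveMemory

/-! ### Bilinearity of the covariance -/

/-- Bilinearity of `cov f g = ∫ f g dμ - (∫ f dμ)(∫ g dμ)` on integrable data:
`cov(f₁ + f₂, g₁ + g₂) = cov(f₁,g₁) + cov(f₁,g₂) + cov(f₂,g₁) + cov(f₂,g₂)`. [folklore] -/
theorem cov_add_add {α : Type*} [MeasurableSpace α] {μ : Measure α} (cov : (α → ℝ) → (α → ℝ) → ℝ)
    (hcov : ∀ f g, cov f g = (∫ z, f z * g z ∂μ) - (∫ z, f z ∂μ) * (∫ z, g z ∂μ))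
    {f₁ f₂ g₁ g₂ : α → ℝ} (hf₁ : Integrable f₁ μ) (hf₂ : Integrable f₂ μ) (hg₁ : Integrable g₁ μ)
    (hg₂ : Integrable g₂ μ) (h₁₁ : Integrable (fun z => f₁ z * g₁ z) μ)
    (h₁₂ : Integrable (fun z => f₁ z * g₂ z) μ) (h₂₁ : Integrable (fun z => f₂ z * g₁ z) μ)
    (h₂₂ : Integrable (fun z => f₂ z * g₂ z) μ) :
    cov (fun z => f₁ z + f₂ z) (fun z => g₁ z + g₂ z) =
      cov f₁ g₁ + cov f₁ g₂ + cov f₂ g₁ + cov f₂ g₂ := by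
  simp only [hcov]
  have e1 : (fun z => (f₁ z + f₂ z) * (g₁ z + g₂ z)) =
      fun z => (f₁ z * g₁ z + f₁ z * g₂ z) + (f₂ z * g₁ z + f₂ z * g₂ z) := by
    funext z; ring
  have hA : Integrable (fun z => f₁ z * g₁ z + f₁ z * g₂ z) μ := h₁₁.add h₁₂
  have hB : Integrable (fun z => f₂ z * g₁ z + f₂ z * g₂ z) μ := h₂₁.add h₂₂
  rw [e1, integral_add hA hB, integral_add h₁₁ h₁₂, integral_add h₂₁ h₂₂,
    integral_add hf₁ hf₂, integral_add hg₁ hg₂]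
  ring

section Pinned

variable {ω₂ lam β : ℝ}

/-! ### Gibbs moments of `p_x²/2` against `μ_T` -/

/-- A continuous observable dominated by `C (1 + H)²` is integrable against the Gibbs MEASURE `μ_T`
(pinned chain, `ω₂ > 0`, `lam, β ≥ 0`, `T > 0`). [folklore] -/
theorem pinnedChain_integrable_gibbsMeasure_of_le (hω : 0 < ω₂) (hl : 0 ≤ lam) (hβ : 0 ≤ β)
    (γ : ℝ) (N : ℕ) {T : ℝ} (hT : 0 < T) {g : PhaseSpace N → ℝ} (hg : Continuous g) {C : ℝ}
    (hle : ∀ z, |g z| ≤ C * (1 + (pinnedChain ω₂ lam β γ).hamiltonian N z) ^ 2) :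
    Integrable g ((pinnedChain ω₂ lam β γ).gibbsMeasure N T) :=
  (pinnedChain ω₂ lam β γ).integrable_gibbsMeasure
    (pinnedChain_integrable_mul_gibbsDensity_of_le hω hl hβ γ N hT hg hle)

/-- Continuous observables with `0 ≤ f ≤ C_f H` and `0 ≤ g ≤ C_g H`: `f` and `f g` are
`μ_T`-integrable. [folklore] -/
theorem pinnedChain_integrable_gibbsMeasure_of_le_hamiltonian (hω : 0 < ω₂) (hl : 0 ≤ lam)
    (hβ : 0 ≤ β) (γ : ℝ) (N : ℕ) {T : ℝ} (hT : 0 < T) {f g : PhaseSpace N → ℝ} (hf : Continuous f)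
    (hg : Continuous g) {Cf Cg : ℝ} (hCf : 0 ≤ Cf) (hCg : 0 ≤ Cg) (hf0 : ∀ z, 0 ≤ f z)
    (hfle : ∀ z, f z ≤ Cf * (pinnedChain ω₂ lam β γ).hamiltonian N z) (hg0 : ∀ z, 0 ≤ g z)
    (hgle : ∀ z, g z ≤ Cg * (pinnedChain ω₂ lam β γ).hamiltonian N z) :
    Integrable f ((pinnedChain ω₂ lam β γ).gibbsMeasure N T) ∧
    Integrable (fun z => f z * g z) ((pinnedChain ω₂ lam β γ).gibbsMeasure N T) := by
  have hH0 : ∀ z, 0 ≤ (pinnedChain ω₂ lam β γ).hamiltonian N z := fun z =>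
    pinnedChain_hamiltonian_nonneg hω.le hl hβ γ N z
  refine ⟨pinnedChain_integrable_gibbsMeasure_of_le hω hl hβ γ N hT hf (C := Cf) fun z => ?_,
    pinnedChain_integrable_gibbsMeasure_of_le hω hl hβ γ N hT (hf.mul hg) (C := Cf * Cg)
      fun z => ?_⟩
  · rw [abs_of_nonneg (hf0 z)]
    refine (hfle z).trans ?_
    nlinarith [mul_nonneg hCf (hH0 z), mul_nonneg hCf (mul_nonneg (hH0 z) (hH0 z))]
  · rw [abs_mul, abs_of_nonneg (hf0 z), abs_of_nonneg (hg0 z)]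
    calc f z * g z ≤ (Cf * (pinnedChain ω₂ lam β γ).hamiltonian N z) *
          (Cg * (pinnedChain ω₂ lam β γ).hamiltonian N z) :=
          mul_le_mul (hfle z) (hgle z) (hg0 z) (mul_nonneg hCf (hH0 z))
      _ ≤ Cf * Cg * (1 + (pinnedChain ω₂ lam β γ).hamiltonian N z) ^ 2 := by
          nlinarith [mul_nonneg (mul_nonneg hCf hCg) (hH0 z), mul_nonneg hCf hCg]

/-- `0 ≤ p_x²/2 ≤ 1·H` and continuity of `p_x²/2` (pinned chain, `lam, β ≥ 0`). [folklore] -/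
theorem pinnedChain_halfSqMomentum_nice (hω : 0 ≤ ω₂) (hl : 0 ≤ lam) (hβ : 0 ≤ β) (γ : ℝ) (N : ℕ)
    (x : Fin N) :
    Continuous (fun z : PhaseSpace N => z.2 x ^ 2 / 2) ∧ (∀ z : PhaseSpace N, 0 ≤ z.2 x ^ 2 / 2) ∧
    ∀ z : PhaseSpace N, z.2 x ^ 2 / 2 ≤ 1 * (pinnedChain ω₂ lam β γ).hamiltonian N z := by
  refine ⟨by fun_prop, fun z => by positivity, fun z => ?_⟩
  have := pinnedChain_sq_momentum_le hω hl hβ γ N z x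
  linarith

/-- **First Gibbs moment**: `∫ p_x²/2 dμ_T = T/2` (`p_x ~ N(0,T)`). [folklore] -/
theorem pinnedChain_integral_halfSqMomentum_gibbsMeasure (hω : 0 < ω₂) (hl : 0 ≤ lam) (hβ : 0 ≤ β)
    (γ : ℝ) (N : ℕ) {T : ℝ} (hT : 0 < T) (x : Fin N) :
    ∫ z, z.2 x ^ 2 / 2 ∂((pinnedChain ω₂ lam β γ).gibbsMeasure N T) = T / 2 := by
  rw [(pinnedChain ω₂ lam β γ).integral_gibbsMeasure]
  have h : (fun z : PhaseSpace N => z.2 x ^ 2 / 2 * (pinnedChain ω₂ lam β γ).gibbsDensity N T z) =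
      fun z => (1 / 2 : ℝ) * (z.2 x ^ 2 * (pinnedChain ω₂ lam β γ).gibbsDensity N T z) := by
    funext z; ring
  rw [h, integral_const_mul, pinnedChain_integral_sq_momentum_mul_gibbsDensity hω hl hβ γ N hT x]
  have hZ : 0 < ∫ z, (pinnedChain ω₂ lam β γ).gibbsDensity N T z :=
    integral_exp_pos (pinnedChain_integrable_gibbsDensity hω hl hβ γ N hT)
  field_simp

/-- **Independence of `p_x` from the rest**: for a continuous `F` with `|F| ≤ C(1+H)` not depending on
`p_x`, `(p_x²/2)·F` is `μ_T`-integrable and `∫ (p_x²/2) F dμ_T = (T/2) ∫ F dμ_T` (Gaussian integration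
by parts in `p_x`). [folklore] -/
theorem pinnedChain_integral_halfSqMomentum_mul_indep_gibbsMeasure (hω : 0 < ω₂) (hl : 0 ≤ lam)
    (hβ : 0 ≤ β) (γ : ℝ) (N : ℕ) {T : ℝ} (hT : 0 < T) (x : Fin N) {F : PhaseSpace N → ℝ}
    (hF : Continuous F) {C : ℝ} (hC : 0 ≤ C)
    (hle : ∀ z, |F z| ≤ C * (1 + (pinnedChain ω₂ lam β γ).hamiltonian N z))
    (hind : ∀ (z : PhaseSpace N) (t : ℝ), F (z.1, Function.update z.2 x t) = F z) :
    Integrable (fun z => z.2 x ^ 2 / 2 * F z) ((pinnedChain ω₂ lam β γ).gibbsMeasure N T) ∧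
    ∫ z, z.2 x ^ 2 / 2 * F z ∂((pinnedChain ω₂ lam β γ).gibbsMeasure N T) =
      T / 2 * ∫ z, F z ∂((pinnedChain ω₂ lam β γ).gibbsMeasure N T) := by
  obtain ⟨-, iFp, hIBP⟩ :=
    pinnedChain_integral_indep_sq_momentum_mul_gibbsDensity hω hl hβ γ N hT x hF hC hle hind
  have h : (fun z : PhaseSpace N =>
      z.2 x ^ 2 / 2 * F z * (pinnedChain ω₂ lam β γ).gibbsDensity N T z) =
      fun z => (1 / 2 : ℝ) * (F z * z.2 x ^ 2 * (pinnedChain ω₂ lam β γ).gibbsDensity N T z) := by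
    funext z; ring
  refine ⟨(pinnedChain ω₂ lam β γ).integrable_gibbsMeasure ?_, ?_⟩
  · rw [h]; exact iFp.const_mul _
  · rw [(pinnedChain ω₂ lam β γ).integral_gibbsMeasure,
      (pinnedChain ω₂ lam β γ).integral_gibbsMeasure, h, integral_const_mul, hIBP]
    ring

/-- **Second Gibbs moments of the kinetic site energies**: `∫ (p_x²/2)(p_y²/2) dμ_T = 3T²/4` if
`x = y` (`E p⁴ = 3T²`) and `= T²/4` if `x ≠ y` (`p_x`, `p_y` independent `N(0,T)`). [folklore] -/
theorem pinnedChain_integral_halfSqMomentum_mul_gibbsMeasure (hω : 0 < ω₂) (hl : 0 ≤ lam)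
    (hβ : 0 ≤ β) (γ : ℝ) (N : ℕ) {T : ℝ} (hT : 0 < T) (x y : Fin N) :
    ∫ z, z.2 x ^ 2 / 2 * (z.2 y ^ 2 / 2) ∂((pinnedChain ω₂ lam β γ).gibbsMeasure N T) =
      if x = y then 3 * T ^ 2 / 4 else T ^ 2 / 4 := by
  rcases eq_or_ne x y with hxy | hxy
  · subst hxy
    rw [if_pos rfl, (pinnedChain ω₂ lam β γ).integral_gibbsMeasure]
    have h : (fun z : PhaseSpace N => z.2 x ^ 2 / 2 * (z.2 x ^ 2 / 2) *
        (pinnedChain ω₂ lam β γ).gibbsDensity N T z) =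
        fun z => (1 / 4 : ℝ) * (z.2 x ^ 4 * (pinnedChain ω₂ lam β γ).gibbsDensity N T z) := by
      funext z; ring
    rw [h, integral_const_mul,
      pinnedChain_integral_fourth_momentum_mul_gibbsDensity hω hl hβ γ N hT x,
      pinnedChain_integral_sq_momentum_mul_gibbsDensity hω hl hβ γ N hT x]
    have hZ : 0 < ∫ z, (pinnedChain ω₂ lam β γ).gibbsDensity N T z :=
      integral_exp_pos (pinnedChain_integrable_gibbsDensity hω hl hβ γ N hT)
    field_simp
    ring
  · rw [if_neg hxy]
    obtain ⟨hc, h0, h1⟩ := pinnedChain_halfSqMomentum_nice hω.le hl hβ γ N y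
    have hyx : y ≠ x := fun h => hxy h.symm
    rw [(pinnedChain_integral_halfSqMomentum_mul_indep_gibbsMeasure hω hl hβ γ N hT x hc zero_le_one
        (fun z => by
          rw [abs_of_nonneg (h0 z)]
          have := h1 z
          have := pinnedChain_hamiltonian_nonneg hω.le hl hβ γ N z
          linarith)
        (fun z t => by simp [Function.update_of_ne hyx])).2,
      pinnedChain_integral_halfSqMomentum_gibbsMeasure hω hl hβ γ N hT y]
    ring

end Pinned

/-! ### The entrywise splitting of the covariance matrix -/

section Package

variable {ω₂ lam β γ : ℝ} {N : ℕ} {T : ℝ}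
  (cov : (PhaseSpace N → ℝ) → (PhaseSpace N → ℝ) → ℝ)
  (hcov : ∀ f g, cov f g = (∫ z, f z * g z ∂((pinnedChain ω₂ lam β γ).gibbsMeasure N T)) -
    (∫ z, f z ∂((pinnedChain ω₂ lam β γ).gibbsMeasure N T)) *
      (∫ z, g z ∂((pinnedChain ω₂ lam β γ).gibbsMeasure N T)))
  (b : Fin N → PhaseSpace N → ℝ)
  (hb : ∀ x z, b x z = (pinnedChain ω₂ lam β γ).U (z.1 x) +
    ∑ j : Fin N, ((if j.val = x.val + 1 then (pinnedChain ω₂ lam β γ).V (z.1 j - z.1 x) / 2 else 0) +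
      (if x.val = j.val + 1 then (pinnedChain ω₂ lam β γ).V (z.1 x - z.1 j) / 2 else 0)))
  (e : Fin N → PhaseSpace N → ℝ)
  (he : ∀ x z, e x z = z.2 x ^ 2 / 2 + (pinnedChain ω₂ lam β γ).U (z.1 x) +
    ∑ j : Fin N, ((if j.val = x.val + 1 then (pinnedChain ω₂ lam β γ).V (z.1 j - z.1 x) / 2 else 0) +
      (if x.val = j.val + 1 then (pinnedChain ω₂ lam β γ).V (z.1 x - z.1 j) / 2 else 0)))
  (hω : 0 < ω₂) (hl : 0 ≤ lam) (hβ : 0 ≤ β) (hT : 0 < T)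

include hb hω hl hβ in
/-- The position parts `b_x` of the split site energies: continuous, `0 ≤ b_x ≤ (N+1) H`,
independent of every momentum. [folklore] -/
theorem potSite_nice (x : Fin N) :
    Continuous (b x) ∧ (∀ z, 0 ≤ b x z) ∧
    (∀ z, b x z ≤ ((N : ℝ) + 1) * (pinnedChain ω₂ lam β γ).hamiltonian N z) ∧
    ∀ (i : Fin N) (z : PhaseSpace N) (t : ℝ), b x (z.1, Function.update z.2 i t) = b x z := by
  refine ⟨?_, fun z => ?_, fun z => ?_, fun i z t => by rw [hb, hb]⟩
  · rw [show b x = _ from funext (hb x)]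
    exact (pinnedChain_continuous_potSiteEnergy ω₂ lam β γ N x).comp continuous_fst
  · rw [hb]; exact pinnedChain_potSiteEnergy_nonneg hω.le hl hβ γ N x z.1
  · rw [hb]; exact pinnedChain_potSiteEnergy_le hω.le hl hβ γ N x z

include hcov hb hω hl hβ hT in
/-- **The cross covariances vanish and the kinetic block is `(T²/2)·1`**:
`cov(p_x²/2 + b_x, p_y²/2 + b_y) = [x = y] T²/2 + cov(b_x, b_y)` under `μ_T`. [folklore] -/
theorem cov_halfSqMomentum_add_potSite (x y : Fin N) :
    cov (fun z => z.2 x ^ 2 / 2 + b x z) (fun z => z.2 y ^ 2 / 2 + b y z) =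
      (if x = y then T ^ 2 / 2 else 0) + cov (b x) (b y) := by
  have hA := fun x => pinnedChain_halfSqMomentum_nice hω.le hl hβ γ N x
  have hB := fun x => potSite_nice b hb hω hl hβ x
  have hH0 : ∀ z, 0 ≤ (pinnedChain ω₂ lam β γ).hamiltonian N z := fun z =>
    pinnedChain_hamiltonian_nonneg hω.le hl hβ γ N z
  have hN1 : (0 : ℝ) ≤ (N : ℝ) + 1 := by positivity
  -- integrability of all products
  have iAA := pinnedChain_integrable_gibbsMeasure_of_le_hamiltonian hω hl hβ γ N hT (hA x).1 (hA y).1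
    zero_le_one zero_le_one (hA x).2.1 (hA x).2.2 (hA y).2.1 (hA y).2.2
  have iAB := pinnedChain_integrable_gibbsMeasure_of_le_hamiltonian hω hl hβ γ N hT (hA x).1 (hB y).1
    zero_le_one hN1 (hA x).2.1 (hA x).2.2 (hB y).2.1 (hB y).2.2.1
  have iBA := pinnedChain_integrable_gibbsMeasure_of_le_hamiltonian hω hl hβ γ N hT (hB x).1 (hA y).1
    hN1 zero_le_one (hB x).2.1 (hB x).2.2.1 (hA y).2.1 (hA y).2.2
  have iBB := pinnedChain_integrable_gibbsMeasure_of_le_hamiltonian hω hl hβ γ N hT (hB x).1 (hB y).1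
    hN1 hN1 (hB x).2.1 (hB x).2.2.1 (hB y).2.1 (hB y).2.2.1
  have iA := fun x => (pinnedChain_integrable_gibbsMeasure_of_le_hamiltonian hω hl hβ γ N hT (hA x).1
    (hA x).1 zero_le_one zero_le_one (hA x).2.1 (hA x).2.2 (hA x).2.1 (hA x).2.2).1
  have iB := fun x => (pinnedChain_integrable_gibbsMeasure_of_le_hamiltonian hω hl hβ γ N hT (hB x).1
    (hB x).1 hN1 hN1 (hB x).2.1 (hB x).2.2.1 (hB x).2.1 (hB x).2.2.1).1
  -- the Gaussian moments
  have m1 := fun x => pinnedChain_integral_halfSqMomentum_gibbsMeasure hω hl hβ γ N hT x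
  have m2 := pinnedChain_integral_halfSqMomentum_mul_gibbsMeasure hω hl hβ γ N hT x y
  have hBle : ∀ (x : Fin N) z,
      |b x z| ≤ ((N : ℝ) + 1) * (1 + (pinnedChain ω₂ lam β γ).hamiltonian N z) := fun x z => by
      rw [abs_of_nonneg ((hB x).2.1 z)]
      nlinarith [(hB x).2.2.1 z, hH0 z]
  have mAB := (pinnedChain_integral_halfSqMomentum_mul_indep_gibbsMeasure hω hl hβ γ N hT x (hB y).1
    hN1 (hBle y) ((hB y).2.2.2 x)).2
  have mBA : ∫ z, b x z * (z.2 y ^ 2 / 2) ∂((pinnedChain ω₂ lam β γ).gibbsMeasure N T) =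
      T / 2 * ∫ z, b x z ∂((pinnedChain ω₂ lam β γ).gibbsMeasure N T) := by
    rw [← (pinnedChain_integral_halfSqMomentum_mul_indep_gibbsMeasure hω hl hβ γ N hT y (hB x).1 hN1
      (hBle x) ((hB x).2.2.2 y)).2]
    exact integral_congr_ae (Eventually.of_forall fun z => mul_comm _ _)
  rw [cov_add_add cov hcov (iA x) (iB x) (iA y) (iB y) iAA.2 iAB.2 iBA.2 iBB.2]
  simp only [hcov]
  rw [m2, m1 x, m1 y, mAB, mBA]
  split_ifs <;> ring

include hcov hb hω hl hβ hT in
/-- **The position block is positive semidefinite**: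
`Σ_x Σ_y ζ_x cov(b_x, b_y) ζ_y = ∫ (B_ζ - μ_T B_ζ)² dμ_T ≥ 0` with `B_ζ = Σ ζ_x b_x` (the `b_x` are
nice observables). [folklore] -/
theorem sum_cov_potSite_nonneg (ζ : Fin N → ℝ) : 0 ≤ ∑ x, ∑ y, ζ x * cov (b x) (b y) * ζ y := by
  have hB := fun x => potSite_nice b hb hω hl hβ x
  set ϑ : ℝ := T⁻¹ / 4 with hϑ
  have hT' : 0 < T⁻¹ := inv_pos.mpr hT
  have hϑ0 : 0 < ϑ := by positivity
  have h2ϑ : 2 * ϑ < 1 / T := by rw [hϑ, one_div]; linarith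
  have hbexp : ∀ x z, |b x z| ≤
      ((N : ℝ) + 1) / ϑ * Real.exp (ϑ * (pinnedChain ω₂ lam β γ).hamiltonian N z) := fun x z => by
    have hH0 := pinnedChain_hamiltonian_nonneg hω.le hl hβ γ N z
    set Hz := (pinnedChain ω₂ lam β γ).hamiltonian N z
    have hexp : ϑ * Hz + 1 ≤ Real.exp (ϑ * Hz) := Real.add_one_le_exp _
    have hHle : Hz ≤ Real.exp (ϑ * Hz) / ϑ := by rw [le_div_iff₀ hϑ0]; nlinarith
    rw [abs_of_nonneg ((hB x).2.1 z)]
    calc b x z ≤ ((N : ℝ) + 1) * Hz := (hB x).2.2.1 z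
      _ ≤ ((N : ℝ) + 1) * (Real.exp (ϑ * Hz) / ϑ) := mul_le_mul_of_nonneg_left hHle (by positivity)
      _ = ((N : ℝ) + 1) / ϑ * Real.exp (ϑ * Hz) := by ring
  have key := pinnedChain_sum_cov_eq_integral_sq_sub hω hl hβ hT h2ϑ (fun x => (hB x).1)
    (C := ((N : ℝ) + 1) / ϑ) (by positivity) hbexp ζ
  simp only [hcov]
  rw [key]
  exact integral_nonneg fun z => sq_nonneg _

include hcov he hω hl hβ hT in
/-- **Free static variance floor, package form**: for generic `cov`, `e` with their defining
equations, `(T²/2) Σ_x ζ_x² ≤ Σ_x Σ_y ζ_x cov(e_x, e_y) ζ_y`. [folklore] -/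
theorem profileVariance_package (ζ : Fin N → ℝ) :
    T ^ 2 / 2 * ∑ x, ζ x ^ 2 ≤ ∑ x, ∑ y, ζ x * cov (e x) (e y) * ζ y := by
  set b : Fin N → PhaseSpace N → ℝ := fun x z => (pinnedChain ω₂ lam β γ).U (z.1 x) +
    ∑ j : Fin N, ((if j.val = x.val + 1 then (pinnedChain ω₂ lam β γ).V (z.1 j - z.1 x) / 2 else 0) +
      (if x.val = j.val + 1 then (pinnedChain ω₂ lam β γ).V (z.1 x - z.1 j) / 2 else 0)) with hbdef
  have hb : ∀ x z, b x z = (pinnedChain ω₂ lam β γ).U (z.1 x) +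
      ∑ j : Fin N, ((if j.val = x.val + 1 then (pinnedChain ω₂ lam β γ).V (z.1 j - z.1 x) / 2 else 0) +
        (if x.val = j.val + 1 then (pinnedChain ω₂ lam β γ).V (z.1 x - z.1 j) / 2 else 0)) :=
    fun _ _ => rfl
  have hex : ∀ x, e x = fun z => z.2 x ^ 2 / 2 + b x z := fun x => funext fun z => by
    rw [he, hb]; ring
  have h1 : ∀ x y, cov (e x) (e y) = (if x = y then T ^ 2 / 2 else 0) + cov (b x) (b y) := by
    intro x y
    rw [hex x, hex y]
    exact cov_halfSqMomentum_add_potSite cov hcov b hb hω hl hβ hT x y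
  have h2 := sum_cov_potSite_nonneg cov hcov b hb hω hl hβ hT ζ
  have hdiag : ∀ x, ∑ y, ζ x * (if x = y then T ^ 2 / 2 else 0) * ζ y = T ^ 2 / 2 * ζ x ^ 2 := by
    intro x
    rw [Finset.sum_eq_single x (fun y _ hyx => by rw [if_neg (Ne.symm hyx)]; ring)
      (fun h => absurd (Finset.mem_univ x) h), if_pos rfl]
    ring
  have h3 : ∑ x, ∑ y, ζ x * cov (e x) (e y) * ζ y =
      T ^ 2 / 2 * ∑ x, ζ x ^ 2 + ∑ x, ∑ y, ζ x * cov (b x) (b y) * ζ y := by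
    simp only [h1, mul_add, add_mul, Finset.sum_add_distrib, hdiag, Finset.mul_sum]
  rw [h3]
  linarith

end Package

/-! ### The registered stub -/

/-- **Stub S3 — the free static variance floor** (Gibbs momenta): under `gibbsMeasure N T` the momenta are
i.i.d. `N(0,T)` and independent of the positions, so for every site profile `ζ`,
`ζᵀχζ = Var(Σ ζ_x e_x) ≥ Var(Σ ζ_x p_x²/2) = (T²/2) Σ ζ_x²`. -/
theorem stub_profileVariance :
    ∀ ω₂ lam β γ : ℝ, 0 < ω₂ → 0 < lam → 0 < β → 0 < γ → ∀ T : ℝ, 0 < T → ∀ N : ℕ, 2 ≤ N →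
    let P := Literature.MathematicalPhysics.KineticTheory.HeatConduction.pinnedChain ω₂ lam β γ;
    let X := Literature.MathematicalPhysics.KineticTheory.HeatConduction.PhaseSpace N;
    let μ : MeasureTheory.Measure X := P.gibbsMeasure N T;
    let cov : (X → ℝ) → (X → ℝ) → ℝ := fun f g => (∫ z, f z * g z ∂μ) - (∫ z, f z ∂μ) * (∫ z, g z ∂μ);
    let e : Fin N → X → ℝ := fun x z => z.2 x ^ 2 / 2 + P.U (z.1 x) +
      ∑ j : Fin N, ((if j.val = x.val + 1 then P.V (z.1 j - z.1 x) / 2 else 0) +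
        (if x.val = j.val + 1 then P.V (z.1 x - z.1 j) / 2 else 0));
    ∀ ζ : Fin N → ℝ,
      T ^ 2 / 2 * ∑ x : Fin N, ζ x ^ 2 ≤ ∑ x : Fin N, ∑ y : Fin N, ζ x * cov (e x) (e y) * ζ y := by
  intro ω₂ lam β γ hω hl hβ _hγ T hT N _hN P X μ cov e ζ
  exact profileVariance_package (ω₂ := ω₂) (lam := lam) (β := β) (γ := γ) (N := N) (T := T)
    cov (fun _ _ => rfl) e (fun _ _ => rfl) hω hl.le hβ.le hT ζ

end Summit.AtomisticToContinuum.FouriersLaw.Theorems.HonestZwanzig.PositiveMemory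

end
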